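import Mathlib
import HarnessLib
import Summits.RiemannHypothesis.RiemannHypothesis.Theorems.IntegerScrewSmoothSectorDefs
import Summits.RiemannHypothesis.RiemannHypothesis.Theorems.ScrewLemmaKProfileBernoulli

/-!
# K♯ family, K1 inputs — the gadgets of the second Euler–Maclaurin step (definitions)

* `bern2 w = (w² − w)/2` — the quadratic periodic primitive of `B̃₁ = fract − ½`
  (`b′ = w − ½`, `b(0) = b(1) = 0`, `|b| ≤ 1/8` on `[0,1]`);
* `betaFun y u = y · bern2 (fract (u/y))` — continuous, right-differentiable everywhere with
  right-derivative `fract(u/y) − ½` (`hasDerivWithinAt_betaFun`);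
* `psiInt g y = ∫ 1_(0,1](u) (fract(u/y) − ½) g′(u) du` — the measurable model of the profile
  deviation `ψ(y) = latticeProfile g y − latticePlateau g` (equal to it for `C¹` data with
  `g(1) = 0`, `∫g = 0`, by the exact Euler–Maclaurin formula `profile_sub_plateau_eq`;
  `StronglyMeasurable` as a parametric integral of a jointly measurable integrand, which sidesteps
  the fact that `g` is arbitrary off `[0,1]`).
The profile FUNCTION `H = ψ·1_(0,1) − h₀·1_[1,∞)` is `SmoothSectorHardy.profileFun`
(`Theorems/SmoothSectorHardyDefs.lean`), not redeclared.  Definitions + elementary lemmas only.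

Ported verbatim (tree conventions: docstrings, split into ≤ 400-line files, `profileFun` reused from
`Theorems/SmoothSectorHardyDefs.lean`) from the desk file of rh-idea-5 g0 (family «LEMMA K♯»),
pub/ideators/rh-idea-5/ProfileBernoulli.lean v5 sha16 4e6baba130239d85 (2026-08-27), §§1–3.
RH-free real analysis; RH is not proved by this and nothing here bears on the truth of RH.
-/

noncomputable section

set_option linter.dupNamespace false

namespace Summit.RiemannHypothesis.RiemannHypothesis.Theorems.IntegerScrew.ProfileBernoulli

open MeasureTheory Set intervalIntegral
open Summit.RiemannHypothesis.RiemannHypothesis.Theorems.IntegerScrew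
open scoped BigOperators

/-- the quadratic periodic primitive of `B̃₁` -/
def bern2 (w : ℝ) : ℝ := (w ^ 2 - w) / 2

/-- `|b(w)| ≤ 1/8` on `[0,1]`. [folklore] -/
theorem abs_bern2_le {w : ℝ} (h0 : 0 ≤ w) (h1 : w ≤ 1) : |bern2 w| ≤ 1 / 8 := by
  unfold bern2
  rw [abs_le]
  constructor <;> nlinarith [sq_nonneg (w - 1 / 2)]

/-- `β(u) = y · b(fract(u/y))` -/
def betaFun (y u : ℝ) : ℝ := y * bern2 (Int.fract (u / y))

/-- `|β(u)| ≤ y/8`. [folklore] -/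
theorem abs_betaFun_le {y : ℝ} (hy : 0 < y) (u : ℝ) : |betaFun y u| ≤ y / 8 := by
  unfold betaFun
  rw [abs_mul, abs_of_pos hy]
  have := abs_bern2_le (Int.fract_nonneg (u / y)) (Int.fract_lt_one (u / y)).le
  calc y * |bern2 (Int.fract (u / y))| ≤ y * (1 / 8) := by gcongr
    _ = y / 8 := by ring

/-- `β` is continuous (`b(0) = b(1)`). [folklore] -/
theorem continuous_betaFun {y : ℝ} (_hy : 0 < y) : Continuous (betaFun y) := by
  have hb : Continuous ((fun w => y * bern2 w) ∘ Int.fract) := by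
    apply ContinuousOn.comp_fract''
    · exact (continuous_const.mul (by unfold bern2; fun_prop)).continuousOn
    · simp [bern2]
  exact hb.comp (continuous_id.div_const y)

/-- `β(0) = 0`. [folklore] -/
theorem betaFun_zero (y : ℝ) : betaFun y 0 = 0 := by simp [betaFun, bern2]

/-- right-derivative of `β` at every point -/
theorem hasDerivWithinAt_betaFun {y : ℝ} (hy : 0 < y) (x : ℝ) :
    HasDerivWithinAt (betaFun y) (Int.fract (x / y) - 1 / 2) (Ioi x) x := by
  set k : ℤ := ⌊x / y⌋ with hk
  -- the smooth branch on [x, (k+1) y)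
  set γ : ℝ → ℝ := fun u => y / 2 * ((u / y - k) * (u / y - k) - (u / y - k)) with hγ
  have hkx : (k:ℝ) ≤ x / y := Int.floor_le _
  have hxk : x / y < (k:ℝ) + 1 := Int.lt_floor_add_one _
  have hxk' : x < ((k:ℝ) + 1) * y := by rw [← div_lt_iff₀ hy]; exact hxk
  have hfr : ∀ u, x ≤ u → u < ((k:ℝ) + 1) * y → Int.fract (u / y) = u / y - k := by
    intro u hxu huk
    rw [Int.fract_eq_iff]
    refine ⟨?_, ?_, ⟨k, by ring⟩⟩
    · rw [sub_nonneg]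
      exact le_trans hkx (by gcongr)
    · rw [sub_lt_iff_lt_add, div_lt_iff₀ hy]; linarith
  have hγβ : ∀ u, x ≤ u → u < ((k:ℝ) + 1) * y → betaFun y u = γ u := by
    intro u hxu huk
    simp only [betaFun, bern2, hγ, hfr u hxu huk]
    ring
  have h0 : HasDerivAt (fun u : ℝ => u / y - k) (1 / y) x := by
    simpa using ((hasDerivAt_id x).div_const y).sub_const (k:ℝ)
  have hA := ((h0.mul h0).sub h0).const_mul (y / 2)
  have h2 : HasDerivAt γ (Int.fract (x / y) - 1 / 2) x := by
    rw [hfr x le_rfl hxk']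
    refine hA.congr_deriv ?_
    field_simp
    ring
  apply (h2.hasDerivWithinAt (s := Ioi x)).congr_of_eventuallyEq
  · have hmem : Ioo x (((k:ℝ) + 1) * y) ∈ nhdsWithin x (Ioi x) := Ioo_mem_nhdsGT hxk'
    filter_upwards [hmem] with u hu
    exact hγβ u hu.1.le hu.2
  · exact hγβ x le_rfl hxk'


/-- measurable model of `ψ` : the Euler–Maclaurin parametric integral. -/
def psiInt (g : ℝ → ℝ) (y : ℝ) : ℝ :=
  ∫ u, (Ioc (0:ℝ) 1).indicator (fun u => (Int.fract (u / y) - 1 / 2) * deriv g u) u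

/-- `psiInt g y = ψ(y)` for `C¹` data with `g(1) = 0`, `∫g = 0` (exact Euler–Maclaurin). [folklore] -/
theorem psiInt_eq {g : ℝ → ℝ} (hC : ContDiffOn ℝ 1 g (Icc 0 1)) (h1 : g 1 = 0)
    (hI : ∫ u in (0:ℝ)..1, g u = 0) {y : ℝ} (hy : 0 < y) :
    psiInt g y = latticeProfile g y - latticePlateau g := by
  rw [profile_sub_plateau_eq hC h1 hI hy, intervalIntegral.integral_of_le zero_le_one, psiInt,
    MeasureTheory.integral_indicator measurableSet_Ioc]

/-- `psiInt g` is strongly measurable (parametric integral). [folklore] -/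
theorem stronglyMeasurable_psiInt (g : ℝ → ℝ) : StronglyMeasurable (psiInt g) := by
  have hF : Measurable (fun p : ℝ × ℝ => (Int.fract (p.2 / p.1) - 1 / 2) * deriv g p.2) :=
    ((measurable_fract.comp (measurable_snd.div measurable_fst)).sub measurable_const).mul
      ((measurable_deriv g).comp measurable_snd)
  have hG : Measurable ((Prod.snd ⁻¹' Ioc (0:ℝ) 1).indicator
      (fun p : ℝ × ℝ => (Int.fract (p.2 / p.1) - 1 / 2) * deriv g p.2)) :=
    hF.indicator (measurableSet_Ioc.preimage measurable_snd)
  have heq : (Function.uncurry fun (y u : ℝ) =>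
      (Ioc (0:ℝ) 1).indicator (fun u => (Int.fract (u / y) - 1 / 2) * deriv g u) u)
      = (Prod.snd ⁻¹' Ioc (0:ℝ) 1).indicator
          (fun p : ℝ × ℝ => (Int.fract (p.2 / p.1) - 1 / 2) * deriv g p.2) := by
    funext p
    rcases p with ⟨y, u⟩
    by_cases hu : u ∈ Ioc (0:ℝ) 1
    · simp [Function.uncurry, hu]
    · simp [Function.uncurry, hu]
  have hsm : StronglyMeasurable (Function.uncurry fun (y u : ℝ) =>
      (Ioc (0:ℝ) 1).indicator (fun u => (Int.fract (u / y) - 1 / 2) * deriv g u) u) := by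
    rw [heq]; exact hG.stronglyMeasurable
  exact hsm.integral_prod_right


end Summit.RiemannHypothesis.RiemannHypothesis.Theorems.IntegerScrew.ProfileBernoulli

end
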